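import Mathlib
import Literature.Analysis.FluidPDE.SuitableWeak
import Literature.Analysis.FluidPDE.WeakSolution
import Literature.Analysis.FluidPDE.Seregin2023.TypeIIEulerZoom
import Literature.Analysis.FluidPDE.NSBoundedSpatialHolder
import Literature.Analysis.FluidPDE.LocalLeraySlabGoodSlices
import Summits.NavierStokesRegularity.NavierStokesRegularity.Theorems.EulerZoomLiouvillePowerGaugeEulerLiouvilleIrrotationalTools
import Summits.NavierStokesRegularity.NavierStokesRegularity.Theses.EulerZoomLiouville
import HarnessLib

/-!
# The IRROTATIONAL stratum of the crux `EulerZoomLiouville.PowerGaugeEulerLiouville`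

Route `EulerZoomLiouville` (NavierStokesRegularity), crux E = stmt-NavierStokesRegularity-19832
`PowerGaugeEulerLiouville`: an ancient local-energy Euler flow `(u, p)` on `(−∞, 0) × ℝ³` (suitable weak,
`ν = 0`, `f = 0`, weak spatial gradient `H`) whose power-gauged CKN quantities at the origin obey Seregin's
bound `a^{2ρ} A(a) + a^{ρ} E(a) + a^{2ρ} D(a) ≤ c` for all `a > 0` vanishes a.e.  The crux is OPEN on the
window `0 < ρ ≤ 1/2` (it contains the Chae–Shvydkoy window for self-similar Euler collapse,
`α = 1 + ρ ∈ (1, 3/2]`); the lead's line (`Cruxes/PowerGaugeEulerLiouville/Lines/birth.lean`) meters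
progress on its open core stub `stub_noCollapseFromZero` through STRATA.  This file (with its spatial
companion `…IrrotationalTools.lean`, first four bullets) lands the POTENTIAL-FLOW stratum, every `ρ > −1`:

* `ae_eq_zero_of_weaklyHarmonic_of_growth` — Liouville for weakly harmonic `h ∈ L¹_loc(ℝ³)` of
  sub-volume quadratic growth `∫_{B(0,r)} |h|² ≤ K r^m`, `m < 3`: `h = 0` a.e. (interior `L^∞–L¹`
  estimate for weakly harmonic functions, tree `exists_const_ae_abs_le_integral_of_weaklyHarmonic`
  [GilbargTrudinger2001 Thm 2.1], plus Cauchy–Schwarz: `|h(x)| ≤ C r^{(m−3)/2} → 0`);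
* `integral_inner_curlPair_eq_zero_of_symm`, `isWeaklyDivFree_of_trace_eq_zero` — a field on `ℝ³`
  whose weak gradient is a.e. SYMMETRIC (`curl = 0`) resp. TRACE-FREE (`div = 0`) annihilates the
  curl-type test fields resp. is weakly divergence free;
* `ae_eq_zero_of_symm_traceFree_of_growth` — hence (tree
  `integral_laplacian_mul_inner_eq_zero_of_curlPair`: the components are weakly harmonic) such a field
  with sub-volume quadratic growth vanishes a.e.;
* `hasScaledLocalEnergyBound_of_gauge` — the `A`-part of the gauge is the tree's
  `Seregin2023.HasScaledLocalEnergyBound (1 − 2ρ) c u` (`∫_{B(a)} |u(s)|² ≤ c a^{1−2ρ}`, `s ∈ (−a², 0)`);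
* `ae_hasWeakGradient_slice_of_slab`, `ae_ae_slice_of_ae_slab` — good time slices on `(−∞,0) × ℝ³`;
* `ae_eq_zero_of_gauge_of_irrotational` — **an IRROTATIONAL member of the power-gauged class (weak
  gradient a.e. symmetric) vanishes a.e., for every `ρ > −1`**: a.e. slice has the symmetric,
  trace-free (`div u = 0`, tree `SerrinBoundedHolder.ae_trace_eq_zero`) weak gradient `H t` and growth
  exponent `m = 1 − 2ρ < 3`;
* `powerGaugeEulerLiouville_irrotational` — the same in the crux's binder shape (the crux VERBATIM plus
  the one hypothesis `curl u = 0`).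

Only the `A`-gauge and `div u = 0` are used — no `E`, no `D`, no local energy inequality, no momentum
equation: like the steady stratum (ns-typeII-p1, `powerGaugeEulerLiouville_steady`) this is a stratum on
which the gauges decide by themselves; it is the ancient-class analogue of the last step of
Chae–Shvydkoy's Thm 4.1 [ChaeShvydkoy2013 = arXiv:1201.6009, p.10: small vorticity profile ⇒ `V`
irrotational ⇒ trivial].  WHAT THIS IS NOT: not NS regularity, not the crux and not its open core —
self-similar collapse profiles are rotational; a kernel-checked stratum `--supports` stmt-19832. [folklore]
-/


noncomputable section

set_option linter.dupNamespace false

open MeasureTheory Set Filter Topology Metric Function TopologicalSpace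
open scoped ENNReal NNReal InnerProductSpace RealInnerProductSpace Laplacian

namespace Summit.NavierStokesRegularity.NavierStokesRegularity.Theorems.PowerGaugeEulerLiouville

open Literature.Analysis Literature.Analysis.FunctionSpaces Literature.Analysis.FluidPDE

/-! ## The gauged `A`-bound as a scaled local-energy bound -/

/-- **The `A`-part of the power gauge is a scaled local-energy bound.**  From
`a^{2ρ} A(a) + a^{ρ} E(a) + a^{2ρ} D(a) ≤ c` for all `a > 0` one gets
`∫_{B(a)} |u(s)|² ≤ c · a^{1−2ρ}` for every `s ∈ (−a², 0)`, i.e. the tree's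
`Seregin2023.HasScaledLocalEnergyBound (1 − 2ρ) c u` (the computation of the planners' rung A,
isolated for reuse by every stratum). [folklore] -/
theorem hasScaledLocalEnergyBound_of_gauge {ρ : ℝ} {u : ℝ → (EuclideanSpace ℝ (Fin 3)) → (EuclideanSpace ℝ (Fin 3))} {p : ℝ → (EuclideanSpace ℝ (Fin 3)) → ℝ}
    {H : ℝ → (EuclideanSpace ℝ (Fin 3)) → (EuclideanSpace ℝ (Fin 3)) →L[ℝ] (EuclideanSpace ℝ (Fin 3))} {c : ℝ≥0}
    (hc : ∀ a : ℝ, 0 < a → ENNReal.ofReal (a ^ (2 * ρ)) * cknA a (0 : ℝ × (EuclideanSpace ℝ (Fin 3))) u +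
        ENNReal.ofReal (a ^ ρ) * cknE a (0 : ℝ × (EuclideanSpace ℝ (Fin 3))) H +
        ENNReal.ofReal (a ^ (2 * ρ)) * cknD a (0 : ℝ × (EuclideanSpace ℝ (Fin 3))) p ≤ (c : ℝ≥0∞)) :
    Seregin2023.HasScaledLocalEnergyBound (1 - 2 * ρ) c u := by
  -- adapted from bc/PowerGaugeEulerLiouville_rung.lean (planner-ns-plan-lens-oqh-typeII-g0)
  intro a ha s hs
  have h1 := hc a ha
  have hAterm : ENNReal.ofReal (a ^ (2 * ρ)) * cknA a (0 : ℝ × (EuclideanSpace ℝ (Fin 3))) u ≤ (c : ℝ≥0∞) :=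
    le_trans (le_trans le_self_add le_self_add) h1
  have hslice : (ENNReal.ofReal a)⁻¹ * ∫⁻ x in ball (0 : (EuclideanSpace ℝ (Fin 3))) a, ‖u s x‖ₑ ^ 2 ≤ cknA a (0 : ℝ × (EuclideanSpace ℝ (Fin 3))) u := by
    unfold cknA
    have hs' : s ∈ Ioo ((0 : ℝ × (EuclideanSpace ℝ (Fin 3))).1 - a ^ 2) (0 : ℝ × (EuclideanSpace ℝ (Fin 3))).1 := by simpa using hs
    exact le_iSup₂ (f := fun t (_ : t ∈ Ioo ((0 : ℝ × (EuclideanSpace ℝ (Fin 3))).1 - a ^ 2) (0 : ℝ × (EuclideanSpace ℝ (Fin 3))).1) =>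
      (ENNReal.ofReal a)⁻¹ * ∫⁻ x in ball (0 : ℝ × (EuclideanSpace ℝ (Fin 3))).2 a, ‖u t x‖ₑ ^ 2) s hs'
  have hB0 : ENNReal.ofReal (a ^ (2 * ρ)) ≠ 0 := by
    rw [ENNReal.ofReal_ne_zero_iff]; exact Real.rpow_pos_of_pos ha _
  have hA0 : ENNReal.ofReal a ≠ 0 := by rw [ENNReal.ofReal_ne_zero_iff]; exact ha
  have h2 : ENNReal.ofReal (a ^ (2 * ρ)) *
      ((ENNReal.ofReal a)⁻¹ * ∫⁻ x in ball (0 : (EuclideanSpace ℝ (Fin 3))) a, ‖u s x‖ₑ ^ 2) ≤ (c : ℝ≥0∞) :=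
    le_trans (mul_le_mul_right hslice _) hAterm
  have h3 : ∫⁻ x in ball (0 : (EuclideanSpace ℝ (Fin 3))) a, ‖u s x‖ₑ ^ 2 ≤
      ENNReal.ofReal a * (ENNReal.ofReal (a ^ (2 * ρ)))⁻¹ * (c : ℝ≥0∞) := by
    have key : ∫⁻ x in ball (0 : (EuclideanSpace ℝ (Fin 3))) a, ‖u s x‖ₑ ^ 2 =
        ENNReal.ofReal a * (ENNReal.ofReal (a ^ (2 * ρ)))⁻¹ *
          (ENNReal.ofReal (a ^ (2 * ρ)) *
            ((ENNReal.ofReal a)⁻¹ * ∫⁻ x in ball (0 : (EuclideanSpace ℝ (Fin 3))) a, ‖u s x‖ₑ ^ 2)) := by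
      rw [← mul_assoc, mul_assoc (ENNReal.ofReal a), ENNReal.inv_mul_cancel hB0 ENNReal.ofReal_ne_top,
        mul_one, ← mul_assoc, ENNReal.mul_inv_cancel hA0 ENNReal.ofReal_ne_top, one_mul]
    rw [key]
    exact mul_le_mul_right h2 _
  refine le_trans h3 (le_of_eq ?_)
  rw [← ENNReal.ofReal_inv_of_pos (Real.rpow_pos_of_pos ha _), ← ENNReal.ofReal_mul ha.le,
    ENNReal.coe_nnreal_eq, ← ENNReal.ofReal_mul (by positivity)]
  congr 1
  rw [mul_comm, Real.rpow_sub ha, Real.rpow_one, div_eq_mul_inv]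

/-! ## Good time slices on the slab `(−∞, 0) × ℝ³` -/

/-- `(−∞, 0)` is the countable union of the intervals `(−(n+1), 0)`. [folklore] -/
theorem iUnion_Ioo_neg_natCast_succ : (⋃ n : ℕ, Ioo (-((n : ℝ) + 1)) 0) = Iio (0 : ℝ) := by
  refine subset_antisymm (iUnion_subset fun n t ht => ht.2) fun t ht => ?_
  obtain ⟨n, hn⟩ := exists_nat_gt (-t)
  exact mem_iUnion.2 ⟨n, ⟨by linarith, ht⟩⟩

/-- **Slices of a weak spatial gradient on the ancient slab.**  For a.e. `t < 0` the slice `H t`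
is a weak gradient of `u t` on `ℝ³`. [folklore] -/
theorem ae_hasWeakGradient_slice_of_slab {u : ℝ → (EuclideanSpace ℝ (Fin 3)) → (EuclideanSpace ℝ (Fin 3))} {H : ℝ → (EuclideanSpace ℝ (Fin 3)) → (EuclideanSpace ℝ (Fin 3)) →L[ℝ] (EuclideanSpace ℝ (Fin 3))}
    (hH : HasWeakSpatialGradientOn (slab (EuclideanSpace ℝ (Fin 3)) (Iio 0) isOpen_Iio) u H) :
    ∀ᵐ t ∂(volume.restrict (Iio (0 : ℝ))), HasWeakGradient (u t) (H t) := by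
  rw [← iUnion_Ioo_neg_natCast_succ, ae_restrict_iUnion_iff]
  intro n
  have hn : HasWeakSpatialGradientOn (slab (EuclideanSpace ℝ (Fin 3)) (Ioo (-((n : ℝ) + 1)) 0) isOpen_Ioo) u H :=
    hH.mono (slab_mono Ioo_subset_Iio_self)
  exact hn.ae_hasWeakFDerivOn_slice_slab

/-- An a.e. statement on the slab `(−∞,0) × ℝ³` holds, for a.e. `t < 0`, a.e. on the slice. [folklore] -/
theorem ae_ae_slice_of_ae_slab {P : ℝ → (EuclideanSpace ℝ (Fin 3)) → Prop}
    (h : ∀ᵐ z ∂(volume.restrict (Iio (0 : ℝ) ×ˢ (univ : Set (EuclideanSpace ℝ (Fin 3))))), P z.1 z.2) :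
    ∀ᵐ t ∂(volume.restrict (Iio (0 : ℝ))), ∀ᵐ x ∂(volume : Measure (EuclideanSpace ℝ (Fin 3))), P t x := by
  have hμ : (volume : Measure (ℝ × (EuclideanSpace ℝ (Fin 3)))).restrict (Iio (0 : ℝ) ×ˢ (univ : Set (EuclideanSpace ℝ (Fin 3)))) =
      (volume.restrict (Iio (0 : ℝ))).prod (volume : Measure (EuclideanSpace ℝ (Fin 3))) := by
    rw [Measure.volume_eq_prod, Measure.restrict_prod_eq_prod_univ]
  rw [hμ] at h
  exact Measure.ae_ae_of_ae_prod h

/-! ## The irrotational stratum -/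

/-- **Irrotational members of the power-gauged ancient Euler class vanish** (every `ρ > −1`, in
particular every `ρ > 0`).  Let `(u, p)` be a suitable weak Euler flow on `(−∞, 0) × ℝ³` with weak
spatial gradient `H` obeying the gauge `a^{2ρ} A(a) + a^ρ E(a) + a^{2ρ} D(a) ≤ c` at the origin for all
`a > 0`, and suppose the flow is IRROTATIONAL: `H(t,x)` is a symmetric linear map for a.e. `(t,x)`
(`curl u = 0`).  Then `u = 0` a.e. on the slab.  Proof: for a.e. `t`, the slice `u t` has the
symmetric, trace-free (`div u = 0`, tree `SerrinBoundedHolder.ae_trace_eq_zero`) weak gradient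
`H t`, hence weakly harmonic components; the `A`-gauge gives `∫_{B(0,r)} |u(t)|² ≤ c r^{1−2ρ}`
(sub-volume growth), so the harmonic Liouville theorem `ae_eq_zero_of_weaklyHarmonic_of_growth`
kills the slice.  Only the `A`-gauge and `div u = 0` are used (no `E`, `D`, local energy inequality
or momentum equation): the potential-flow stratum of the crux, the ancient-class analogue of the last
step of Chae–Shvydkoy's Thm 4.1 [arXiv:1201.6009] («`V` irrotational ⇒ trivial»). [folklore] -/
theorem ae_eq_zero_of_gauge_of_irrotational {ρ : ℝ} (hρ : -1 < ρ) {u : ℝ → (EuclideanSpace ℝ (Fin 3)) → (EuclideanSpace ℝ (Fin 3))} {p : ℝ → (EuclideanSpace ℝ (Fin 3)) → ℝ}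
    {H : ℝ → (EuclideanSpace ℝ (Fin 3)) → (EuclideanSpace ℝ (Fin 3)) →L[ℝ] (EuclideanSpace ℝ (Fin 3))} {c : ℝ≥0}
    (hsw : IsSuitableWeakSolutionOn (slab (EuclideanSpace ℝ (Fin 3)) (Iio 0) isOpen_Iio) 0 0 u p)
    (hH : HasWeakSpatialGradientOn (slab (EuclideanSpace ℝ (Fin 3)) (Iio 0) isOpen_Iio) u H)
    (hc : ∀ a : ℝ, 0 < a → ENNReal.ofReal (a ^ (2 * ρ)) * cknA a (0 : ℝ × (EuclideanSpace ℝ (Fin 3))) u +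
        ENNReal.ofReal (a ^ ρ) * cknE a (0 : ℝ × (EuclideanSpace ℝ (Fin 3))) H +
        ENNReal.ofReal (a ^ (2 * ρ)) * cknD a (0 : ℝ × (EuclideanSpace ℝ (Fin 3))) p ≤ (c : ℝ≥0∞))
    (hirr : ∀ᵐ z ∂(volume.restrict (Iio (0 : ℝ) ×ˢ (univ : Set (EuclideanSpace ℝ (Fin 3))))),
      ∀ v w : (EuclideanSpace ℝ (Fin 3)), ⟪H z.1 z.2 v, w⟫ = ⟪H z.1 z.2 w, v⟫) :
    uncurry u =ᵐ[volume.restrict (Iio (0 : ℝ) ×ˢ (univ : Set (EuclideanSpace ℝ (Fin 3))))] 0 := by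
  have hA := hasScaledLocalEnergyBound_of_gauge hc
  -- good times: weak gradient slice, symmetric, trace-free
  have h1 := ae_hasWeakGradient_slice_of_slab hH
  have h2 := ae_ae_slice_of_ae_slab (P := fun t x => ∀ v w : (EuclideanSpace ℝ (Fin 3)), ⟪H t x v, w⟫ = ⟪H t x w, v⟫) hirr
  have h3 : ∀ᵐ t ∂(volume.restrict (Iio (0 : ℝ))), ∀ᵐ x ∂(volume : Measure (EuclideanSpace ℝ (Fin 3))),
      ∑ j, H t x (EuclideanSpace.single j (1 : ℝ)) j = 0 := by
    have htr := SerrinBoundedHolder.ae_trace_eq_zero hsw.distributional hH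
    refine ae_ae_slice_of_ae_slab (P := fun t x => ∑ j, H t x (EuclideanSpace.single j (1 : ℝ)) j = 0) ?_
    rw [ae_restrict_iff' (measurableSet_Iio.prod MeasurableSet.univ)]
    filter_upwards [htr] with z hz hmem
    exact hz (by simpa [slab] using hmem)
  have ht0 : ∀ᵐ t ∂(volume.restrict (Iio (0 : ℝ))), t < 0 := by
    rw [ae_restrict_iff' measurableSet_Iio]; exact Eventually.of_forall fun t ht => ht
  -- every good slice vanishes
  have hslice : ∀ᵐ t ∂(volume.restrict (Iio (0 : ℝ))), u t =ᵐ[volume] 0 := by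
    filter_upwards [h1, h2, h3, ht0] with t h1 h2 h3 ht
    refine ae_eq_zero_of_symm_traceFree_of_growth h1 h2 h3 (K := (c : ℝ)) (m := 1 - 2 * ρ)
      (r₀ := Real.sqrt (-t)) (by linarith) fun r hr hr0 => ?_
    have hs : t ∈ Ioo (-(r ^ 2)) 0 := by
      refine ⟨?_, ht⟩
      have h4 : Real.sqrt (-t) ^ 2 = -t := Real.sq_sqrt (by linarith)
      nlinarith [Real.sqrt_nonneg (-t)]
    exact hA r hr0 t hs
  -- Tonelli on the slab
  have hmeas : AEStronglyMeasurable (uncurry u)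
      (volume.restrict (Iio (0 : ℝ) ×ˢ (univ : Set (EuclideanSpace ℝ (Fin 3))))) := by
    have := hH.locallyIntegrableOn.aestronglyMeasurable
    simpa [slab] using this
  have hint : ∫⁻ z in Iio (0 : ℝ) ×ˢ (univ : Set (EuclideanSpace ℝ (Fin 3))), ‖uncurry u z‖ₑ = 0 := by
    have hm := hmeas.aemeasurable.enorm
    rw [Measure.volume_eq_prod, ← Measure.restrict_prod_eq_prod_univ] at hm ⊢
    rw [lintegral_prod _ hm]
    have hzero : (fun t : ℝ => ∫⁻ y, ‖uncurry u (t, y)‖ₑ) =ᵐ[volume.restrict (Iio 0)] 0 := by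
      filter_upwards [hslice] with t ht
      have : (fun y => ‖uncurry u (t, y)‖ₑ) =ᵐ[volume] fun _ => 0 := by
        filter_upwards [ht] with y hy
        simp [uncurry, hy]
      rw [lintegral_congr_ae this]
      simp
    rw [lintegral_congr_ae hzero]
    simp
  have hae := (lintegral_eq_zero_iff' hmeas.aemeasurable.enorm).1 hint
  filter_upwards [hae] with z hz
  simpa using hz

/-- **The irrotational stratum of the crux `PowerGaugeEulerLiouville`, in the crux's binder shape**:
the crux VERBATIM with the one extra hypothesis that the weak gradient is a.e. symmetric
(`curl u = 0`). [folklore] -/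
theorem powerGaugeEulerLiouville_irrotational :
    ∀ ρ : ℝ, 0 < ρ → ∀ (u : ℝ → EuclideanSpace ℝ (Fin 3) → EuclideanSpace ℝ (Fin 3))
      (p : ℝ → EuclideanSpace ℝ (Fin 3) → ℝ)
      (H : ℝ → EuclideanSpace ℝ (Fin 3) → EuclideanSpace ℝ (Fin 3) →L[ℝ] EuclideanSpace ℝ (Fin 3)) (c : ℝ≥0),
      IsSuitableWeakSolutionOn (slab (EuclideanSpace ℝ (Fin 3)) (Set.Iio 0) isOpen_Iio) 0 0 u p →
      HasWeakSpatialGradientOn (slab (EuclideanSpace ℝ (Fin 3)) (Set.Iio 0) isOpen_Iio) u H →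
      (∀ a : ℝ, 0 < a → ENNReal.ofReal (a ^ (2 * ρ)) * cknA a (0 : ℝ × EuclideanSpace ℝ (Fin 3)) u +
        ENNReal.ofReal (a ^ ρ) * cknE a (0 : ℝ × EuclideanSpace ℝ (Fin 3)) H +
        ENNReal.ofReal (a ^ (2 * ρ)) * cknD a (0 : ℝ × EuclideanSpace ℝ (Fin 3)) p ≤ (c : ℝ≥0∞)) →
      (∀ᵐ z ∂(volume.restrict (Set.Iio (0 : ℝ) ×ˢ (Set.univ : Set (EuclideanSpace ℝ (Fin 3))))),
        ∀ v w : EuclideanSpace ℝ (Fin 3), ⟪H z.1 z.2 v, w⟫ = ⟪H z.1 z.2 w, v⟫) →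
      Function.uncurry u =ᵐ[volume.restrict (Set.Iio (0 : ℝ) ×ˢ (Set.univ : Set (EuclideanSpace ℝ (Fin 3))))] 0 :=
  fun _ hρ _ _ _ _ hsw hH hc hirr => ae_eq_zero_of_gauge_of_irrotational (by linarith) hsw hH hc hirr

end Summit.NavierStokesRegularity.NavierStokesRegularity.Theorems.PowerGaugeEulerLiouville

end
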